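import Mathlib.Topology.Algebra.ClopenNhdofOne
import Mathlib.Topology.Algebra.OpenSubgroup
import Mathlib.Tactic.Group

/-!
# Estrangement is uniform: a finite-level form of [SemiAnbd] Def. 2.4 (iv) at one vertex

Mochizuki, *Semi-graphs of anabelioids*, Publ. RIMS **42** (2006) 221–322, Def. 2.4 (iv) p. 26
[cite: MochizukiSemiAnbd2006, Def 2.4(iv) p.26] (estranged: "the intersection in `Π_v` of `Π_b` with
any subgroup of the form `g · Π_{b'} · g⁻¹` … is trivial") and the proof of Thm. 3.7 (iii) p. 41
[cite: MochizukiSemiAnbd2006, Thm 3.7(iii) p.41] ("if `H` fixes two vertices … joined by a single edge",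
read at the FINITE levels `𝒢_{∞,j}`).  At a finite level the vertex group `Π_v` is only seen modulo an
open normal subgroup `L`, and the two branch images `Π_b L / L`, `g Π_{b'} g⁻¹ L / L` may meet; this
proof-only file records that the meeting is UNIFORMLY small: by compactness of the profinite group
`Π_v`, for every open `M ∋ 1` there is ONE open normal `N₀ ≤ Π_v` such that
`(q Π_b q⁻¹ · N₀) ∩ (q' Π_{b'} q'⁻¹ · N₀) ⊆ M` simultaneously for ALL conjugators `q, q'` (distinct
branches), resp. for all `q, q'` whose quotient stays away from `Π_b` (same branch, malnormal clause).
Pure topological group theory over Mathlib (abc-iut cell, layer L3, gap G-t6g3-2b desk note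
R1b-DESK §0 "Lemma E"; no semi-graph vocabulary is imported, no definition is introduced).

* `EstrangedUniform.exists_openNormalSubgroup_thicken_inter_subset` — the core uniform-thickening
  lemma: if `conj q '' P ∩ conj q' '' P' ⊆ M` for all `(q, q')` in a closed set `R` of pairs, `P, P'`
  compact, `M` open, then for some open normal `N`, `(conj q '' P · N) ∩ (conj q' '' P' · N) ⊆ M` on `R`;
* `…_of_estranged` (distinct branches) and `…_of_malnormal` (same branch) — the two clauses of
  Def. 2.4 (iv) in the tree's form `P ⊓ P'.map (MulAut.conj g) = ⊥`.
-/

namespace Literature.AnabelianGeometry.SemiGraphs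

namespace EstrangedUniform

open scoped Pointwise
open Set

section ConjImage

variable {G : Type*} [Group G]

/-- The image of a subgroup under conjugation, as a set. [cite: MochizukiSemiAnbd2006, Def 2.4(iv) p.26] -/
theorem coe_map_conj (P : Subgroup G) (q : G) :
    ((P.map (MulAut.conj q).toMonoidHom : Subgroup G) : Set G) = (MulAut.conj q) '' (P : Set G) := by
  ext x; simp

end ConjImage

variable {G : Type*} [Group G] [TopologicalSpace G] [IsTopologicalGroup G] [CompactSpace G]
  [TotallyDisconnectedSpace G] [T2Space G]

omit [TotallyDisconnectedSpace G] in
/-- The "thickened membership" set `{((q, q'), x) | x ∈ (q P q⁻¹) · N}` used in the compactness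
argument, as the image of a compact set (hence closed). [cite: MochizukiSemiAnbd2006, Def 2.4(iv) p.26] -/
theorem isClosed_setOf_mem_conj_mul (P : Set G) (hP : IsCompact P) (N : Set G) (hN : IsCompact N)
    (i : G × G → G) (hi : Continuous i) :
    IsClosed {t : (G × G) × G | t.2 ∈ (MulAut.conj (i t.1)) '' P * N} := by
  have hc : Continuous fun z : (G × G) × (G × G) => (z.1, i z.1 * z.2.1 * (i z.1)⁻¹ * z.2.2) := by
    fun_prop
  have hK : IsCompact ((univ : Set (G × G)) ×ˢ (P ×ˢ N)) := isCompact_univ.prod (hP.prod hN)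
  have himage : {t : (G × G) × G | t.2 ∈ (MulAut.conj (i t.1)) '' P * N} =
      (fun z : (G × G) × (G × G) => (z.1, i z.1 * z.2.1 * (i z.1)⁻¹ * z.2.2)) ''
        ((univ : Set (G × G)) ×ˢ (P ×ˢ N)) := by
    ext t
    constructor
    · intro ht
      obtain ⟨a, ha, n, hn, hx⟩ := Set.mem_mul.mp ht
      obtain ⟨p, hp, rfl⟩ := ha
      refine ⟨(t.1, (p, n)), ⟨mem_univ _, hp, hn⟩, ?_⟩
      refine Prod.ext rfl ?_
      simpa [MulAut.conj_apply] using hx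
    · rintro ⟨⟨qq, p, n⟩, ⟨-, hp, hn⟩, rfl⟩
      simpa [MulAut.conj_apply] using Set.mul_mem_mul (mem_image_of_mem (MulAut.conj (i qq)) hp) hn
  rw [himage]
  exact (hK.image hc).isClosed

/-- **Uniform thickening** (the compactness core of "Lemma E"): `P, P'` compact subsets of a profinite
group, `R` a closed set of pairs of conjugators such that `q P q⁻¹ ∩ q' P' q'⁻¹ ⊆ M` for every
`(q, q') ∈ R`, `M` open.  Then ONE open normal subgroup `N` thickens all these intersections inside
`M` at once: `(q P q⁻¹ · N) ∩ (q' P' q'⁻¹ · N) ⊆ M` for every `(q, q') ∈ R`.  Proof: the sets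
`U_N := {((q,q'),x) | x ∉ q P q⁻¹ N ∨ x ∉ q' P' q'⁻¹ N}` form a directed open cover of the compact
`R × Mᶜ`. [cite: MochizukiSemiAnbd2006, Thm 3.7(iii) p.41] -/
theorem exists_openNormalSubgroup_thicken_inter_subset (P P' : Set G) (hP : IsCompact P)
    (hP' : IsCompact P') (R : Set (G × G)) (hR : IsClosed R) (M : Set G) (hM : IsOpen M)
    (h : ∀ qq' ∈ R, (MulAut.conj qq'.1) '' P ∩ (MulAut.conj qq'.2) '' P' ⊆ M) :
    ∃ N : OpenNormalSubgroup G, ∀ qq' ∈ R,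
      (MulAut.conj qq'.1) '' P * (N : Set G) ∩ ((MulAut.conj qq'.2) '' P' * (N : Set G)) ⊆ M := by
  classical
  -- the compact parameter space
  set K : Set ((G × G) × G) := R ×ˢ Mᶜ with hKdef
  have hKc : IsCompact K := (hR.prod hM.isClosed_compl).isCompact
  -- the directed open cover
  let A : OpenNormalSubgroup G → Set ((G × G) × G) := fun N =>
    {t | t.2 ∈ (MulAut.conj t.1.1) '' P * (N : Set G)}
  let B : OpenNormalSubgroup G → Set ((G × G) × G) := fun N =>
    {t | t.2 ∈ (MulAut.conj t.1.2) '' P' * (N : Set G)}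
  let U : OpenNormalSubgroup G → Set ((G × G) × G) := fun N => (A N ∩ B N)ᶜ
  have hAc : ∀ N, IsClosed (A N) := fun N =>
    isClosed_setOf_mem_conj_mul P hP N N.toOpenSubgroup.isClosed.isCompact Prod.fst continuous_fst
  have hBc : ∀ N, IsClosed (B N) := fun N =>
    isClosed_setOf_mem_conj_mul P' hP' N N.toOpenSubgroup.isClosed.isCompact Prod.snd continuous_snd
  have hUo : ∀ N, IsOpen (U N) := fun N => ((hAc N).inter (hBc N)).isOpen_compl
  have hmono : ∀ {N N' : OpenNormalSubgroup G}, N ≤ N' → U N' ⊆ U N := by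
    intro N N' hle t ht hmem
    apply ht
    refine ⟨?_, ?_⟩
    · exact mul_subset_mul_left (show (N : Set G) ⊆ (N' : Set G) from hle) hmem.1
    · exact mul_subset_mul_left (show (N : Set G) ⊆ (N' : Set G) from hle) hmem.2
  have hdir : Directed (· ⊆ ·) U := fun N₁ N₂ =>
    ⟨N₁ ⊓ N₂, hmono inf_le_left, hmono inf_le_right⟩
  -- the cover property: a point outside a compact set stays outside a uniform thickening of it
  have key : ∀ (C : Set G), IsCompact C → ∀ x ∉ C, ∃ N : OpenNormalSubgroup G, x ∉ C * (N : Set G) := by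
    intro C hC x hx
    have hW : IsOpen {g : G | x * g⁻¹ ∉ C} :=
      (hC.isClosed.isOpen_compl).preimage (by fun_prop)
    obtain ⟨N, hN⟩ := ProfiniteGrp.exist_openNormalSubgroup_sub_open_nhds_of_one hW (by simpa using hx)
    refine ⟨N, ?_⟩
    rintro ⟨c, hc, n, hn, rfl⟩
    have := hN hn
    simp only [mem_setOf_eq, mul_inv_cancel_right] at this
    exact this hc
  have hconj : ∀ q : G, Continuous (MulAut.conj q : G → G) := fun q => by
    change Continuous fun g : G => q * g * q⁻¹
    fun_prop
  obtain ⟨N₁, -⟩ := ProfiniteGrp.exist_openNormalSubgroup_sub_open_nhds_of_one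
    (isOpen_univ : IsOpen (univ : Set G)) (mem_univ 1)
  haveI : Nonempty (OpenNormalSubgroup G) := ⟨N₁⟩
  have hcover : K ⊆ ⋃ N, U N := by
    rintro ⟨⟨q, q'⟩, x⟩ ⟨hqq, hxM⟩
    have hx : x ∉ (MulAut.conj q) '' P ∩ (MulAut.conj q') '' P' := fun hx => hxM (h (q, q') hqq hx)
    rw [mem_inter_iff, not_and_or] at hx
    rcases hx with hx | hx
    · obtain ⟨N, hN⟩ := key _ (hP.image (hconj q)) x hx
      exact mem_iUnion.2 ⟨N, fun hmem => hN hmem.1⟩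
    · obtain ⟨N, hN⟩ := key _ (hP'.image (hconj q')) x hx
      exact mem_iUnion.2 ⟨N, fun hmem => hN hmem.2⟩
  obtain ⟨N₀, hN₀⟩ := hKc.elim_directed_cover U hUo hcover hdir
  refine ⟨N₀, ?_⟩
  rintro ⟨q, q'⟩ hqq x ⟨hx₁, hx₂⟩
  by_contra hxM
  exact hN₀ (show ((q, q'), x) ∈ K from ⟨hqq, hxM⟩) ⟨hx₁, hx₂⟩

/-- **Lemma E, distinct branches** ([SemiAnbd] Def. 2.4 (iv), estranged, first clause, made uniform):
if the closed subgroups `P, P'` of a profinite group satisfy `P ⊓ g P' g⁻¹ = ⊥` for every `g`, then for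
every open `M ∋ 1` there is an open normal subgroup `N` with
`(q P q⁻¹ · N) ∩ (q' P' q'⁻¹ · N) ⊆ M` for ALL `q, q'`. [cite: MochizukiSemiAnbd2006, Def 2.4(iv) p.26] -/
theorem exists_openNormalSubgroup_of_estranged (P P' : Subgroup G) (hP : IsClosed (P : Set G))
    (hP' : IsClosed (P' : Set G))
    (hest : ∀ g : G, P ⊓ P'.map (MulAut.conj g).toMonoidHom = ⊥)
    (M : Set G) (hM : IsOpen M) (h1 : (1 : G) ∈ M) :
    ∃ N : OpenNormalSubgroup G, ∀ q q' : G,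
      ((P.map (MulAut.conj q).toMonoidHom : Subgroup G) : Set G) * (N : Set G) ∩
        (((P'.map (MulAut.conj q').toMonoidHom : Subgroup G) : Set G) * (N : Set G)) ⊆ M := by
  have hcore := exists_openNormalSubgroup_thicken_inter_subset (P : Set G) (P' : Set G)
    hP.isCompact hP'.isCompact univ isClosed_univ M hM (by
      rintro ⟨q, q'⟩ - x ⟨⟨p, hp, rfl⟩, ⟨p', hp', hpp'⟩⟩
      -- `q p q⁻¹ = q' p' q'⁻¹` forces `p ∈ P ⊓ (q⁻¹ q') P' (q⁻¹ q')⁻¹ = ⊥`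
      have hmem : p ∈ P ⊓ P'.map (MulAut.conj (q⁻¹ * q')).toMonoidHom := by
        refine ⟨hp, ⟨p', hp', ?_⟩⟩
        have this : q' * p' * q'⁻¹ = q * p * q⁻¹ := by simpa [MulAut.conj_apply] using hpp'
        change (q⁻¹ * q') * p' * (q⁻¹ * q')⁻¹ = p
        calc (q⁻¹ * q') * p' * (q⁻¹ * q')⁻¹ = q⁻¹ * (q' * p' * q'⁻¹) * q := by group
          _ = q⁻¹ * (q * p * q⁻¹) * q := by rw [this]
          _ = p := by group
      rw [hest] at hmem
      have hp1 : p = 1 := by simpa using hmem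
      subst hp1
      simpa using h1)
  obtain ⟨N, hN⟩ := hcore
  exact ⟨N, fun q q' => by simpa only [coe_map_conj] using hN (q, q') (mem_univ _)⟩

/-- **Lemma E, same branch** ([SemiAnbd] Def. 2.4 (iv), estranged, second clause `g ∉ Π_b`, made
uniform): if the closed subgroup `P` satisfies `P ⊓ g P g⁻¹ = ⊥` for every `g ∉ P`, then for every
open `M ∋ 1` and open `M' ∋ 1` there is an open normal subgroup `N` with
`(q P q⁻¹ · N) ∩ (q' P q'⁻¹ · N) ⊆ M` for all `q, q'` with `q⁻¹ q' ∉ P · M'` (conjugators whose classes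
stay `M'`-apart). [cite: MochizukiSemiAnbd2006, Def 2.4(iv) p.26] -/
theorem exists_openNormalSubgroup_of_malnormal (P : Subgroup G) (hP : IsClosed (P : Set G))
    (hmal : ∀ g : G, g ∉ P → P ⊓ P.map (MulAut.conj g).toMonoidHom = ⊥)
    (M : Set G) (hM : IsOpen M) (h1 : (1 : G) ∈ M) (M' : Set G) (hM' : IsOpen M') (h1' : (1 : G) ∈ M') :
    ∃ N : OpenNormalSubgroup G, ∀ q q' : G, q⁻¹ * q' ∉ (P : Set G) * M' →
      ((P.map (MulAut.conj q).toMonoidHom : Subgroup G) : Set G) * (N : Set G) ∩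
        (((P.map (MulAut.conj q').toMonoidHom : Subgroup G) : Set G) * (N : Set G)) ⊆ M := by
  -- the admissible pairs form a closed set
  have hR : IsClosed {qq' : G × G | qq'.1⁻¹ * qq'.2 ∉ (P : Set G) * M'} := by
    have ho : IsOpen ((P : Set G) * M') := hM'.mul_left
    exact (ho.preimage (by fun_prop : Continuous fun qq' : G × G => qq'.1⁻¹ * qq'.2)).isClosed_compl
  have hcore := exists_openNormalSubgroup_thicken_inter_subset (P : Set G) (P : Set G)
    hP.isCompact hP.isCompact _ hR M hM (by
      rintro ⟨q, q'⟩ hqq x ⟨⟨p, hp, rfl⟩, ⟨p', hp', hpp'⟩⟩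
      have hnot : q⁻¹ * q' ∉ P := by
        intro hmem
        exact hqq ⟨q⁻¹ * q', hmem, 1, h1', by simp⟩
      have hmem : p ∈ P ⊓ P.map (MulAut.conj (q⁻¹ * q')).toMonoidHom := by
        refine ⟨hp, ⟨p', hp', ?_⟩⟩
        have this : q' * p' * q'⁻¹ = q * p * q⁻¹ := by simpa [MulAut.conj_apply] using hpp'
        change (q⁻¹ * q') * p' * (q⁻¹ * q')⁻¹ = p
        calc (q⁻¹ * q') * p' * (q⁻¹ * q')⁻¹ = q⁻¹ * (q' * p' * q'⁻¹) * q := by group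
          _ = q⁻¹ * (q * p * q⁻¹) * q := by rw [this]
          _ = p := by group
      rw [hmal _ hnot] at hmem
      have hp1 : p = 1 := by simpa using hmem
      subst hp1
      simpa using h1)
  obtain ⟨N, hN⟩ := hcore
  exact ⟨N, fun q q' hqq => by simpa only [coe_map_conj] using hN (q, q') hqq⟩

/-! ### Tower form: along a decreasing sequence of levels the thickening is eventually small -/

omit [TotallyDisconnectedSpace G] [T2Space G] in
/-- In a compact group, a decreasing sequence of closed subgroups meeting in `{1}` eventually lies in
any given open subgroup (the levels `Π_v ∩ N_k` of a cofinal tower enter every open normal subgroup of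
`Π_v`). [cite: MochizukiSemiAnbd2006, Thm 3.7(iii) p.41] -/
theorem exists_level_subset_of_antitone (L : ℕ → OpenNormalSubgroup G) (hL : Antitone L)
    (hinter : ∀ x : G, (∀ k, x ∈ L k) → x = 1) (N₀ : OpenNormalSubgroup G) :
    ∃ k₀ : ℕ, ∀ k, k₀ ≤ k → ((L k : Set G) ⊆ (N₀ : Set G)) := by
  -- the closed sets `L k` have intersection `{1} ⊆ N₀`; compactness of the complement of `N₀`
  have hcl : ∀ k, IsClosed ((L k : Set G)) := fun k => (L k).toOpenSubgroup.isClosed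
  have hK : IsCompact ((N₀ : Set G)ᶜ) := N₀.toOpenSubgroup.isOpen.isClosed_compl.isCompact
  have hdir : Directed (· ⊇ ·) fun k => (L k : Set G) := by
    intro i j
    refine ⟨max i j, ?_, ?_⟩
    · exact fun x hx => hL (le_max_left i j) hx
    · exact fun x hx => hL (le_max_right i j) hx
  have hempty : (N₀ : Set G)ᶜ ∩ ⋂ k, (L k : Set G) = ∅ := by
    ext x
    simp only [mem_inter_iff, mem_compl_iff, mem_iInter, SetLike.mem_coe, mem_empty_iff_false,
      iff_false, not_and, not_forall]
    intro hx
    by_contra hall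
    push Not at hall
    exact hx (by rw [hinter x hall]; exact one_mem N₀)
  obtain ⟨k₀, hk₀⟩ := hK.elim_directed_family_closed (fun k => (L k : Set G)) hcl hempty hdir
  refine ⟨k₀, fun k hk x hx => ?_⟩
  by_contra hxN
  have : x ∈ (N₀ : Set G)ᶜ ∩ (L k₀ : Set G) := ⟨hxN, hL hk hx⟩
  rw [hk₀] at this
  exact this

/-- **Lemma E along a tower, distinct branches**: for estranged closed subgroups `P, P'` and a decreasing
sequence of open normal "level" subgroups `L k` with trivial intersection, every open `M ∋ 1` swallows
`(q P q⁻¹ · L k) ∩ (q' P' q'⁻¹ · L k)` for all `q, q'` as soon as `k ≥ k₀(M)` — the finite-level reading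
of [SemiAnbd] Def. 2.4 (iv) used at the levels `𝒢_{∞,k}` of Thm. 3.7 (iii).
[cite: MochizukiSemiAnbd2006, Thm 3.7(iii) p.41] -/
theorem exists_level_of_estranged (P P' : Subgroup G) (hP : IsClosed (P : Set G))
    (hP' : IsClosed (P' : Set G)) (hest : ∀ g : G, P ⊓ P'.map (MulAut.conj g).toMonoidHom = ⊥)
    (L : ℕ → OpenNormalSubgroup G) (hL : Antitone L) (hinter : ∀ x : G, (∀ k, x ∈ L k) → x = 1)
    (M : Set G) (hM : IsOpen M) (h1 : (1 : G) ∈ M) :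
    ∃ k₀ : ℕ, ∀ k, k₀ ≤ k → ∀ q q' : G,
      ((P.map (MulAut.conj q).toMonoidHom : Subgroup G) : Set G) * (L k : Set G) ∩
        (((P'.map (MulAut.conj q').toMonoidHom : Subgroup G) : Set G) * (L k : Set G)) ⊆ M := by
  obtain ⟨N₀, hN₀⟩ := exists_openNormalSubgroup_of_estranged P P' hP hP' hest M hM h1
  obtain ⟨k₀, hk₀⟩ := exists_level_subset_of_antitone L hL hinter N₀
  refine ⟨k₀, fun k hk q q' x hx => hN₀ q q' ⟨?_, ?_⟩⟩
  · exact mul_subset_mul_left (hk₀ k hk) hx.1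
  · exact mul_subset_mul_left (hk₀ k hk) hx.2

/-- **Lemma E along a tower, same branch**: for a malnormal closed subgroup `P` and levels `L k` as
above, every open `M ∋ 1` swallows `(q P q⁻¹ · L k) ∩ (q' P q'⁻¹ · L k)` for `k ≥ k₀(M, M')` and all
conjugators with `q⁻¹ q' ∉ P · M'` — in applications `M'` is the level `L j` of a FIXED lower level `j`,
so the alternative `q⁻¹ q' ∈ P · L j` says that the two edges over the branch `b` have the same image at
level `j` (they "fold"). [cite: MochizukiSemiAnbd2006, Thm 3.7(iii) p.41] -/
theorem exists_level_of_malnormal (P : Subgroup G) (hP : IsClosed (P : Set G))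
    (hmal : ∀ g : G, g ∉ P → P ⊓ P.map (MulAut.conj g).toMonoidHom = ⊥)
    (L : ℕ → OpenNormalSubgroup G) (hL : Antitone L) (hinter : ∀ x : G, (∀ k, x ∈ L k) → x = 1)
    (M : Set G) (hM : IsOpen M) (h1 : (1 : G) ∈ M) (M' : Set G) (hM' : IsOpen M') (h1' : (1 : G) ∈ M') :
    ∃ k₀ : ℕ, ∀ k, k₀ ≤ k → ∀ q q' : G, q⁻¹ * q' ∉ (P : Set G) * M' →
      ((P.map (MulAut.conj q).toMonoidHom : Subgroup G) : Set G) * (L k : Set G) ∩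
        (((P.map (MulAut.conj q').toMonoidHom : Subgroup G) : Set G) * (L k : Set G)) ⊆ M := by
  obtain ⟨N₀, hN₀⟩ := exists_openNormalSubgroup_of_malnormal P hP hmal M hM h1 M' hM' h1'
  obtain ⟨k₀, hk₀⟩ := exists_level_subset_of_antitone L hL hinter N₀
  refine ⟨k₀, fun k hk q q' hqq x hx => hN₀ q q' hqq ⟨?_, ?_⟩⟩
  · exact mul_subset_mul_left (hk₀ k hk) hx.1
  · exact mul_subset_mul_left (hk₀ k hk) hx.2

end EstrangedUniform

end Literature.AnabelianGeometry.SemiGraphs
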